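import Mathlib
import Summits.KontsevichZagierPeriods.Zeta5Search.Elimination.DictBridgeStrata
import HarnessLib

/-!
# The three-term law on the ghost face `{1,6}` and the face stratum of gen-1's bridge (E-L21; fam-elim gen 24)

HONEST FRAMING: systematic search; no irrationality claim unless certified — identities among the rational Taylor
data `U, V, W` of the Ball–Rivoal family and gen-1's dictionary values `(Q, P̂, P)`; nothing about sizes/irrationality.

OUR work (Summit side; `families/elim/FAMILY.md` §17).  On the ghost face `c₁ = c₆ = n+1`, `c₀ = 2n+1` of the dual
Brown–Zudilin box the two face slot factors of `numPoly c` are each `(x)_{c₀+1}`, so the summand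
`R_c = numPoly_c(x)/((x)_{c₀+1})⁶` is a FIVE-slot summand of the fourth-power family; its canonical `U` vanishes
(`Elimination/DictBridgeFace.coeffU_face16`) and — THIS FILE, PROVED — its `W` and `V` obey ONE three-term contiguity
relation along slot `7` (`face16_threeTerm`):
  `Γ₂(c)·X(c+2e₇) + Γ₁(c)·X(c+e₇) + Γ₀(c)·X(c) = 0`,   `X ∈ {W, V}`,
  `Γ₂ = (c₀−c₇+1)·d`,  `Γ₀ = −(c₀−c₇+1)(c₇+1)·Π`,  `Γ₁ = Π − E − d(c₇+2)(c₀−c₇)(c₀−c₇+1)`,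
  `Π = ∏_{k=2}^{5}(c₀−c_k−c₇)`, `E = ∏_{k=2}^{5}(c_k+1)`, `d = d(c) = 3c₀ − Σ_j c_j`
(predicted from the two face recurrences and checked EXACTLY at all 939 face points of levels `3, 5, 7` before the
proof, `HOME/pub-zeta5-fam-elim/g24/tt/face16_threeterm.py`).  PROOF: the Pochhammer numerator satisfies the SUMMABLE
combination `Γ₀·numPoly(c) + Γ₁·numPoly(c+e₇) + Γ₂·numPoly(c+2e₇) = g(X+1)X⁶ − g(X)(X+c₀)⁶` (`face16_threeTerm_poly`)
with the face telescoper `g = −(c₀−c₇+1)·(X+c₀)(X−1)·H_c` (`faceTelescoper`), `H_c` (`faceH`) being the tree's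
`hPoly c` with the two face slots replaced by `(X)_{n+1}(X+n+1)_n`, so that `H_c(x+1)x⁷`, `H_c(x)(x+c₀)⁷` are the
Pochhammer part of `numPoly c` times `∏_{k∈{2,3,4,5,7}}(x+c_k)` resp. `∏(x+c₀−c_k)` (`faceH_eval_succ_mul_seven`,
`faceH_eval_mul_seven`: the face slots contribute NO linear factor — which is why the relation has three terms, not
four as `WedgeDictionaryTopRelation.top_fourTerm`); the remaining scalar identity (Newton expansion of the face
quadratic) is one `ring` (`face_scalar_identity`); `deg g + 1 ≤ 6c₀` for `d(c) ≥ 1` and `g(1) = 0`, so the tree's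
summability principle (`WedgeDictionaryFaceAbel.coeff_rel_of_summable` for `W`, `WedgeDictionaryCoeffV.coeffV_rel_of_summable4`
for `V`) gives the law.  CONSEQUENCES, by pure algebra: Abel's lemma gives the slot-`7` face recurrence
`d·X(c+e₇) = −(c₇+1)Π·X(c)` of `X = V∧W` (`casVW_bump6_of_threeTerm`); with the tree's diagonal-shift law (DS)
(`Elimination/PencilConnection.dictionary_dsShift7` at `c`, `c+e₇`, `bump_dsShift`: `X(DSc) = X₁₂ − λX₀₂ + λλ′X₀₁`)
and the scalar identity `Γ₀ + λΓ₁ + λλ′Γ₂ = −(c₀−c₇+1)(c₇+1)E` also `d·X(DSc) = −(c₇+1)E·X(c)`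
(`casVW_dsShift_of_threeTerm`).  Hence `casVWFace16_holds` (node `CasVWFace16` of `Elimination/DictBridgeFace`,
PROVED: the ratios of the closed form CF-VW-face), `dictBridgeFace16_holds` (gen-1's four-term relation `DictBridge`
on the whole ghost-face stratum, PROVED) and `dictBridge_of_levelOne : DictBridgeLevelOne → DictBridge` — gen-1's
GLOBAL node now rests on the three explicit level-`1` clusters alone (`Elimination/DictBridgeStrata.DictBridgeLevelOne`).
What this is NOT: the level-`1` clusters (nine rational identities, verified exactly outside Lean) are not evaluated
in Lean; nothing about sizes, denominators or irrationality; the class verdict is unchanged (T1 NO / T2 NO / T4 YES).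
-/

open Finset Polynomial

namespace Summit.KontsevichZagierPeriods.Zeta5Search.Elimination

open Summit.KontsevichZagierPeriods.Zeta5Search.DualSeries
open Summit.KontsevichZagierPeriods.Zeta5Search.WedgeDictionary
open Literature.NumberTheory.Transcendental
open Literature.NumberTheory.Transcendental.BallRivoal (pochPoly eval_pochPoly)

/-! ### 1. The coefficients of the face law -/

/-- `Π(c) = ∏_{k=2}^{5}(c₀ − c_k − c₇)`. -/
def facePi (c : ℕ → ℤ) : ℚ :=
  ((c 0 : ℚ) - c 2 - c 7) * ((c 0 : ℚ) - c 3 - c 7) * ((c 0 : ℚ) - c 4 - c 7) * ((c 0 : ℚ) - c 5 - c 7)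

/-- `E(c) = ∏_{k=2}^{5}(c_k + 1)`. -/
def faceE (c : ℕ → ℤ) : ℚ := ((c 2 : ℚ) + 1) * ((c 3 : ℚ) + 1) * ((c 4 : ℚ) + 1) * ((c 5 : ℚ) + 1)

/-- `Γ₂(c) = (c₀ − c₇ + 1)·d(c)`, the leading coefficient of the face law. -/
def faceG2 (c : ℕ → ℤ) : ℚ := ((c 0 : ℚ) - c 7 + 1) * (dOf c : ℚ)

/-- `Γ₁(c) = Π − E − d(c₇+2)(c₀−c₇)(c₀−c₇+1)`, the middle coefficient of the face law. -/
def faceG1 (c : ℕ → ℤ) : ℚ :=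
  facePi c - faceE c - (dOf c : ℚ) * ((c 7 : ℚ) + 2) * ((c 0 : ℚ) - c 7) * ((c 0 : ℚ) - c 7 + 1)

/-- `Γ₀(c) = −(c₀ − c₇ + 1)(c₇ + 1)·Π`, the trailing coefficient of the face law. -/
def faceG0 (c : ℕ → ℤ) : ℚ := -(((c 0 : ℚ) - c 7 + 1) * ((c 7 : ℚ) + 1) * facePi c)

/-! ### 2. The two face recurrences of `V∧W` from a three-term law (Abel; Abel + (DS)) -/

/-- **Abel's lemma on the face.**  The three-term law gives the slot-`7` recurrence of `X = V∧W`: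
`d·X(c+e₇) = −(c₇+1)Π·X(c)`. -/
theorem casVW_bump6_of_threeTerm {c : ℕ → ℤ} (hf : ((c 0 : ℚ) - c 7 + 1) ≠ 0)
    (hW : faceG2 c * coeffW (bump (bump c 6) 6) + faceG1 c * coeffW (bump c 6) + faceG0 c * coeffW c = 0)
    (hV : faceG2 c * coeffV (bump (bump c 6) 6) + faceG1 c * coeffV (bump c 6) + faceG0 c * coeffV c = 0) :
    casVW (bump c 6) * (dOf c : ℚ) = -(((c 7 : ℚ) + 1) * facePi c) * casVW c := by
  have key : ((c 0 : ℚ) - c 7 + 1) *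
      (casVW (bump c 6) * (dOf c : ℚ) - -(((c 7 : ℚ) + 1) * facePi c) * casVW c) = 0 := by
    unfold casVW
    unfold faceG2 faceG0 at hW hV
    linear_combination coeffV (bump c 6) * hW - coeffW (bump c 6) * hV
  rcases mul_eq_zero.mp key with h | h
  · exact absurd h hf
  · exact sub_eq_zero.mp h

/-- **The diagonal recurrence on the face.**  With (DS) at `c` and `c + e₇` the three-term law gives
`d·X(DSc) = −(c₇+1)E·X(c)` for `X = V∧W`. -/
theorem casVW_dsShift_of_threeTerm {c : ℕ → ℤ} (hc : InBox c) (hd : 1 ≤ dOf c) (h7 : c 7 + 1 ≤ c 0)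
    (hf : ((c 0 : ℚ) - c 7 + 1) ≠ 0)
    (hW : faceG2 c * coeffW (bump (bump c 6) 6) + faceG1 c * coeffW (bump c 6) + faceG0 c * coeffW c = 0)
    (hV : faceG2 c * coeffV (bump (bump c 6) 6) + faceG1 c * coeffV (bump c 6) + faceG0 c * coeffV c = 0) :
    casVW (dsShift c) * (dOf c : ℚ) = -(((c 7 : ℚ) + 1) * faceE c) * casVW c := by
  have hb1 : InBox (bump c 6) := inBox_bump6 c hc (by omega)
  have hd1 : dOf (bump c 6) = dOf c - 1 := dOf_bump c (mem_range.2 (by norm_num))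
  obtain ⟨-, dW0, dV0⟩ := dictionary_dsShift7 c hc (by omega) (by omega)
  obtain ⟨-, dW1, dV1⟩ :=
    dictionary_dsShift7 (bump c 6) hb1 (by rw [hd1]; omega) (by rw [bump6_seven, bump_zero]; omega)
  have key : ((c 0 : ℚ) - c 7 + 1) *
      (casVW (dsShift c) * (dOf c : ℚ) - -(((c 7 : ℚ) + 1) * faceE c) * casVW c) = 0 := by
    unfold casVW
    rw [bump_dsShift, dW0, dV0, dW1, dV1, dsLam_six, dsLam_six_bump6]
    unfold faceG2 faceG1 faceG0 at hW hV
    linear_combination (coeffV (bump c 6) - ((c 7 : ℚ) + 1) * ((c 0 : ℚ) - c 7 + 1) * coeffV c) * hW -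
      (coeffW (bump c 6) - ((c 7 : ℚ) + 1) * ((c 0 : ℚ) - c 7 + 1) * coeffW c) * hV
  rcases mul_eq_zero.mp key with h | h
  · exact absurd h hf
  · exact sub_eq_zero.mp h

/-! ### 3. Pochhammer bookkeeping for the two face slots -/

/-- Face slot, shift by the level: `(x)_{n+1}(x+μ)_n·(x+ν) = (x)_{n+1}(x+ν−μ+1)_{n+1}` for `μ = n+1`, `ν = 2n+1`. -/
theorem face_slot_N (x μ ν : ℚ) (n : ℕ) (hμ : μ = (n : ℚ) + 1) (hν : ν = 2 * (n : ℚ) + 1) :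
    BallRivoal.poch x (n + 1) * BallRivoal.poch (x + μ) n * (x + ν) =
      BallRivoal.poch x (n + 1) * BallRivoal.poch (x + (ν - μ + 1)) (n + 1) * 1 := by
  subst hμ hν
  rw [show x + (2 * (n : ℚ) + 1 - ((n : ℚ) + 1) + 1) = x + ((n : ℚ) + 1) by ring,
    poch_succ_right (x + ((n : ℚ) + 1)) n]
  ring

/-- Face slot, shift by zero: `(x+1)_{n+1}(x+1+μ)_n·x = (x)_{n+1}(x+ν−μ+1)_{n+1}` for `μ = n+1`, `ν = 2n+1`. -/
theorem face_slot_zero (x μ ν : ℚ) (n : ℕ) (hμ : μ = (n : ℚ) + 1) (hν : ν = 2 * (n : ℚ) + 1) :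
    BallRivoal.poch (x + 1) (n + 1) * BallRivoal.poch (x + 1 + μ) n * x =
      BallRivoal.poch x (n + 1) * BallRivoal.poch (x + (ν - μ + 1)) (n + 1) * 1 := by
  subst hμ hν
  rw [show x + (2 * (n : ℚ) + 1 - ((n : ℚ) + 1) + 1) = x + ((n : ℚ) + 1) by ring,
    show x + 1 + ((n : ℚ) + 1) = x + ((n : ℚ) + 1) + 1 by ring]
  have h1 := poch_succ_left x (n + 1)
  have h2 := poch_succ_right x (n + 1)
  have h3 := poch_succ_left (x + ((n : ℚ) + 1)) n
  push_cast at h2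
  linear_combination (-BallRivoal.poch (x + ((n : ℚ) + 1) + 1) n) * h1 +
    BallRivoal.poch (x + ((n : ℚ) + 1) + 1) n * h2 - BallRivoal.poch x (n + 1) * h3

/-! ### 4. The face Pochhammer part `H_c` and its two evaluations -/

/-- `H_c`: the tree's `hPoly c` with the face slots `j ∈ {1,6}` (indices `0, 5`) carrying `(X)_{c_j}(X+c_j)_{c_j−1}`. -/
noncomputable def faceH (c : ℕ → ℤ) : ℚ[X] :=
  ∏ j ∈ range 7, (pochPoly 0 (c (j + 1)).toNat *
    (if j = 0 ∨ j = 5 then pochPoly (c (j + 1) : ℚ) ((c (j + 1)).toNat - 1)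
      else pochPoly ((c 0 - c (j + 1) : ℤ) : ℚ) (c (j + 1)).toNat))

/-- The face telescoper `g = −(c₀−c₇+1)·(X+c₀)(X−1)·H_c`. -/
noncomputable def faceTelescoper (c : ℕ → ℤ) : ℚ[X] :=
  C (-((c 0 : ℚ) - c 7 + 1)) * ((X + C (c 0 : ℚ)) * (X - C 1) * faceH c)

/-- Evaluation of `H_c`. -/
theorem eval_faceH (c : ℕ → ℤ) (x : ℚ) :
    (faceH c).eval x = ∏ j ∈ range 7, (BallRivoal.poch x (c (j + 1)).toNat *
      (if j = 0 ∨ j = 5 then BallRivoal.poch (x + (c (j + 1) : ℚ)) ((c (j + 1)).toNat - 1)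
        else BallRivoal.poch (x + ((c 0 - c (j + 1) : ℤ) : ℚ)) (c (j + 1)).toNat)) := by
  unfold faceH
  rw [eval_prod]
  refine prod_congr rfl fun j _ => ?_
  split_ifs with h
  · rw [eval_mul, eval_pochPoly, eval_pochPoly, add_zero]
  · rw [eval_mul, eval_pochPoly, eval_pochPoly, add_zero]

/-- The weights `∏_j w_j` with `w_j = 1` on the face slots: `= ∏_{k∈{2,3,4,5,7}} (x + u_k)`. -/
theorem face_weights (x : ℚ) (u : ℕ → ℚ) :
    ∏ j ∈ range 7, (if j = 0 ∨ j = 5 then (1 : ℚ) else (x + u (j + 1))) =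
      (x + u 2) * (x + u 3) * (x + u 4) * (x + u 5) * (x + u 7) := by
  simp [prod_range_succ]

/-- `H_c(x)(x+c₀)⁷ = A_c(x)·∏_{k∈{2,3,4,5,7}}(x+c₀−c_k)`, `A_c` the Pochhammer part of `numPoly c`, on the face. -/
theorem faceH_eval_mul_seven (c : ℕ → ℤ) (hc : InBox c) {n : ℕ} (h0 : c 0 = 2 * n + 1) (h1 : c 1 = n + 1)
    (h6 : c 6 = n + 1) (x : ℚ) :
    (faceH c).eval x * (x + (c 0 : ℚ)) ^ 7 =
      (∏ j ∈ range 7, (BallRivoal.poch x (c (j + 1)).toNat *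
        BallRivoal.poch (x + ((c 0 - c (j + 1) + 1 : ℤ) : ℚ)) (c (j + 1)).toNat)) *
        ∏ j ∈ range 7, (if j = 0 ∨ j = 5 then (1 : ℚ) else (x + ((c 0 : ℚ) - c (j + 1)))) := by
  rw [eval_faceH, show (x + (c 0 : ℚ)) ^ 7 = ∏ _j ∈ range 7, (x + (c 0 : ℚ)) by rw [prod_const, card_range],
    ← prod_mul_distrib, ← prod_mul_distrib]
  refine prod_congr rfl fun j hj => ?_
  have hν : ((c 0 : ℤ) : ℚ) = 2 * (n : ℚ) + 1 := by exact_mod_cast h0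
  by_cases hs : j = 0 ∨ j = 5
  · rw [if_pos hs, if_pos hs]
    have hcj : c (j + 1) = n + 1 := by rcases hs with rfl | rfl <;> simpa
    have hm : (c (j + 1)).toNat = n + 1 := by omega
    have hμ : ((c (j + 1) : ℤ) : ℚ) = (n : ℚ) + 1 := by exact_mod_cast hcj
    rw [hm, Nat.add_sub_cancel]
    push_cast
    exact face_slot_N x _ _ n hμ hν
  · rw [if_neg hs, if_neg hs]
    have hm : (((c (j + 1)).toNat : ℕ) : ℚ) = (c (j + 1) : ℚ) := by
      exact_mod_cast Int.toNat_of_nonneg (hc.2 j hj).1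
    have key := slot_shift_N x (c 0 : ℚ) (c (j + 1) : ℚ) (c (j + 1)).toNat hm
    push_cast
    linear_combination (-1 : ℚ) * key

/-- `H_c(x+1)x⁷ = A_c(x)·∏_{k∈{2,3,4,5,7}}(x+c_k)` on the face. -/
theorem faceH_eval_succ_mul_seven (c : ℕ → ℤ) (hc : InBox c) {n : ℕ} (h0 : c 0 = 2 * n + 1) (h1 : c 1 = n + 1)
    (h6 : c 6 = n + 1) (x : ℚ) :
    (faceH c).eval (x + 1) * x ^ 7 =
      (∏ j ∈ range 7, (BallRivoal.poch x (c (j + 1)).toNat *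
        BallRivoal.poch (x + ((c 0 - c (j + 1) + 1 : ℤ) : ℚ)) (c (j + 1)).toNat)) *
        ∏ j ∈ range 7, (if j = 0 ∨ j = 5 then (1 : ℚ) else (x + (c (j + 1) : ℚ))) := by
  rw [eval_faceH, show x ^ 7 = ∏ _j ∈ range 7, x by rw [prod_const, card_range], ← prod_mul_distrib,
    ← prod_mul_distrib]
  refine prod_congr rfl fun j hj => ?_
  have hν : ((c 0 : ℤ) : ℚ) = 2 * (n : ℚ) + 1 := by exact_mod_cast h0
  by_cases hs : j = 0 ∨ j = 5
  · rw [if_pos hs, if_pos hs]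
    have hcj : c (j + 1) = n + 1 := by rcases hs with rfl | rfl <;> simpa
    have hm : (c (j + 1)).toNat = n + 1 := by omega
    have hμ : ((c (j + 1) : ℤ) : ℚ) = (n : ℚ) + 1 := by exact_mod_cast hcj
    rw [hm, Nat.add_sub_cancel]
    push_cast
    exact face_slot_zero x _ _ n hμ hν
  · rw [if_neg hs, if_neg hs]
    have hm : (((c (j + 1)).toNat : ℕ) : ℚ) = (c (j + 1) : ℚ) := by
      exact_mod_cast Int.toNat_of_nonneg (hc.2 j hj).1
    have key := slot_shift_zero x (c 0 : ℚ) (c (j + 1) : ℚ) (c (j + 1)).toNat hm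
    push_cast
    linear_combination (-1 : ℚ) * key

/-! ### 5. The scalar identity (Newton expansion of the face quadratic) -/

/-- `(2x+N)[Γ₀ + Γ₁θ_β + Γ₂θ_βθ_{β+1}] = −(N−β+1)[(x+β)(x+N+1)∏_{k=2}^{5}(x+c_k) − (x+N−β)(x−1)∏_{k=2}^{5}(x+N−c_k)]`
with the face value `d = 2N − 1 − (c₂+c₃+c₄+c₅+β)` of `d(c)` substituted into `Γ₀, Γ₁, Γ₂`. -/
theorem face_scalar_identity (N c2 c3 c4 c5 β x : ℚ) :
    (2 * x + N) *
        (-((N - β + 1) * (β + 1) * ((N - c2 - β) * (N - c3 - β) * (N - c4 - β) * (N - c5 - β))) +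
          ((N - c2 - β) * (N - c3 - β) * (N - c4 - β) * (N - c5 - β) -
              (c2 + 1) * (c3 + 1) * (c4 + 1) * (c5 + 1) -
              (2 * N - 1 - (c2 + c3 + c4 + c5 + β)) * (β + 2) * (N - β) * (N - β + 1)) *
            ((x + β) * (x + (N - β))) +
          (N - β + 1) * (2 * N - 1 - (c2 + c3 + c4 + c5 + β)) *
            ((x + β) * (x + (N - β))) * ((x + (β + 1)) * (x + (N - β - 1)))) =
      -(N - β + 1) * ((x + β) * (x + (N + 1)) * ((x + c2) * (x + c3) * (x + c4) * (x + c5)) -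
        (x + (N - β)) * (x - 1) * ((x + (N - c2)) * (x + (N - c3)) * (x + (N - c4)) * (x + (N - c5)))) := by
  ring

/-! ### 6. The three-term relation along slot `7`, as a polynomial identity -/

/-- **The summable three-term combination on the ghost face.**  For `c` in the box with `c₀ = 2n+1`,
`c₁ = c₆ = n+1`: `Γ₀·numPoly(c) + Γ₁·numPoly(c+e₇) + Γ₂·numPoly(c+2e₇) = g(X+1)X⁶ − g(X)(X+c₀)⁶`,
`g = faceTelescoper c`. -/
theorem face16_threeTerm_poly (c : ℕ → ℤ) (hc : InBox c) {n : ℕ} (h0 : c 0 = 2 * n + 1) (h1 : c 1 = n + 1)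
    (h6 : c 6 = n + 1) :
    C (faceG0 c) * numPoly c + C (faceG1 c) * numPoly (bump c 6) + C (faceG2 c) * numPoly (bump (bump c 6) 6) =
      (faceTelescoper c).comp (X + C 1) * X ^ 6 - faceTelescoper c * (X + C (((c 0).toNat : ℕ) : ℚ)) ^ 6 := by
  have hi7 : (6 : ℕ) ∈ range 7 := mem_range.2 (by norm_num)
  have hβ0 : 0 ≤ c (6 + 1) := (hc.2 6 hi7).1
  have hN : (((c 0).toNat : ℕ) : ℚ) = (c 0 : ℚ) := by exact_mod_cast Int.toNat_of_nonneg hc.1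
  have hdz : dOf c = 2 * c 0 - 1 - (c 2 + c 3 + c 4 + c 5 + c 7) := by
    unfold dOf
    simp only [sum_range_succ, sum_range_zero, Nat.reduceAdd]
    omega
  have hdq : (dOf c : ℚ) = 2 * (c 0 : ℚ) - 1 - ((c 2 : ℚ) + c 3 + c 4 + c 5 + c 7) := by exact_mod_cast hdz
  have e1 : numPoly (bump c 6) = numPoly c * ((X + C (c (6 + 1) : ℚ)) * (X + C ((c 0 - c (6 + 1) : ℤ) : ℚ))) :=
    numPoly_update c hi7 hβ0
  have e2 : numPoly (bump (bump c 6) 6) =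
      numPoly (bump c 6) * ((X + C (bump c 6 (6 + 1) : ℚ)) * (X + C ((bump c 6 0 - bump c 6 (6 + 1) : ℤ) : ℚ))) :=
    numPoly_update (bump c 6) hi7 (by rw [bump_self]; omega)
  simp only [bump_self, bump_zero, Nat.reduceAdd] at e1 e2
  apply Polynomial.funext
  intro x
  have hHA := faceH_eval_mul_seven c hc h0 h1 h6 x
  have hH1A := faceH_eval_succ_mul_seven c hc h0 h1 h6 x
  rw [face_weights x (fun k => ((c 0 : ℚ) - c k))] at hHA
  rw [face_weights x (fun k => (c k : ℚ))] at hH1A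
  have estar := face_scalar_identity (c 0 : ℚ) (c 2) (c 3) (c 4) (c 5) (c 7) x
  rw [e2, e1]
  simp only [faceTelescoper, faceG0, faceG1, faceG2, facePi, faceE, hdq, eval_mul, eval_add, eval_sub,
    eval_comp, eval_pow, eval_C, eval_X, eval_numPoly, hN]
  push_cast at hHA hH1A estar ⊢
  linear_combination (∏ j ∈ range 7, (BallRivoal.poch x (c (j + 1)).toNat *
      BallRivoal.poch (x + ((c 0 : ℚ) - (c (j + 1) : ℚ) + 1)) (c (j + 1)).toNat)) * estar +
    ((c 0 : ℚ) - c 7 + 1) * (x + (c 0 : ℚ) + 1) * hH1A - ((c 0 : ℚ) - c 7 + 1) * (x - 1) * hHA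

/-! ### 7. The degree bound and the boundary value of the telescoper -/

/-- `deg g + 1 ≤ 6c₀` as soon as `d(c) ≥ 1` (on the face). -/
theorem natDegree_faceTelescoper_succ_le (c : ℕ → ℤ) (hc : InBox c) {n : ℕ} (h0 : c 0 = 2 * n + 1)
    (h1 : c 1 = n + 1) (h6 : c 6 = n + 1) (hd : 1 ≤ dOf c) :
    (faceTelescoper c).natDegree + 1 ≤ 6 * (c 0).toNat := by
  have hH : (faceH c).natDegree ≤ ∑ j ∈ range 7, ((c (j + 1)).toNat +
      (if j = 0 ∨ j = 5 then (c (j + 1)).toNat - 1 else (c (j + 1)).toNat)) := by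
    unfold faceH
    refine (natDegree_prod_le _ _).trans (sum_le_sum fun j _ => natDegree_mul_le.trans (add_le_add ?_ ?_))
    · exact natDegree_pochPoly_le _ _
    · split_ifs
      · exact natDegree_pochPoly_le _ _
      · exact natDegree_pochPoly_le _ _
  have h2 : ((X + C (c 0 : ℚ)) * (X - C 1)).natDegree ≤ 2 := by
    refine natDegree_mul_le.trans ?_
    rw [natDegree_X_add_C, natDegree_X_sub_C]
  have h3 : (faceTelescoper c).natDegree ≤ 2 + ∑ j ∈ range 7, ((c (j + 1)).toNat +
      (if j = 0 ∨ j = 5 then (c (j + 1)).toNat - 1 else (c (j + 1)).toNat)) := by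
    unfold faceTelescoper
    exact (natDegree_C_mul_le _ _).trans (natDegree_mul_le.trans (add_le_add h2 hH))
  simp only [sum_range_succ, sum_range_zero, Nat.reduceAdd] at h3
  norm_num at h3
  obtain ⟨hc0, hcj⟩ := hc
  have h2' := (hcj 1 (by simp)).1
  have h3' := (hcj 2 (by simp)).1
  have h4' := (hcj 3 (by simp)).1
  have h5' := (hcj 4 (by simp)).1
  have h7' := (hcj 6 (by simp)).1
  unfold dOf at hd
  simp only [sum_range_succ, sum_range_zero, Nat.reduceAdd] at hd h2' h3' h4' h5' h7'
  omega

/-- `g(1) = 0`: the telescoper has the factor `X − 1`, so the boundary term of the `V`-relation vanishes. -/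
theorem eval_faceTelescoper_one (c : ℕ → ℤ) : (faceTelescoper c).eval 1 = 0 := by
  simp [faceTelescoper]

/-! ### 8. The three-term law for `W` and `V` -/

/-- **The three-term law of `W` and `V` on the ghost face.**  For `c` in the box on the face `c₁ = c₆ = (c₀+1)/2`
with `d(c) ≥ 1` and `2c₇ + 3 ≤ c₀`: `Γ₂·X(c+2e₇) + Γ₁·X(c+e₇) + Γ₀·X(c) = 0` for `X = W` and `X = V`. -/
theorem face16_threeTerm (c : ℕ → ℤ) (hc : InBox c) (h1 : 2 * c 1 = c 0 + 1) (h6 : 2 * c 6 = c 0 + 1)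
    (hd : 1 ≤ dOf c) (h7 : 2 * c 7 + 3 ≤ c 0) :
    faceG2 c * coeffW (bump (bump c 6) 6) + faceG1 c * coeffW (bump c 6) + faceG0 c * coeffW c = 0 ∧
      faceG2 c * coeffV (bump (bump c 6) 6) + faceG1 c * coeffV (bump c 6) + faceG0 c * coeffV c = 0 := by
  have hc0 : 0 ≤ c 0 := hc.1
  obtain ⟨n, hn⟩ : ∃ n : ℕ, c 1 = (n : ℤ) + 1 := ⟨(c 1 - 1).toNat, by omega⟩
  have h0' : c 0 = 2 * n + 1 := by omega
  have h6' : c 6 = n + 1 := by omega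
  have hi7 : (6 : ℕ) ∈ range 7 := mem_range.2 (by norm_num)
  set c1 := bump c 6 with hc1def
  set c2 := bump c1 6 with hc2def
  have e10 : c1 0 = c 0 := bump_zero c 6
  have e20 : c2 0 = c 0 := (bump_zero c1 6).trans e10
  have e17 : c1 7 = c 7 + 1 := bump6_seven c
  have hd1 : dOf c1 = dOf c - 1 := dOf_bump c hi7
  have hd2 : dOf c2 = dOf c - 2 := by rw [hc2def, dOf_bump c1 hi7, hd1]; ring
  have hB1 : InBox c1 := inBox_bump6 c hc (by omega)
  have hB2 : InBox c2 := inBox_bump6 c1 hB1 (by rw [e17, e10]; omega)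
  have hN : 1 ≤ (c 0).toNat := by omega
  have hpoly := face16_threeTerm_poly c hc h0' hn h6'
  have hg := natDegree_faceTelescoper_succ_le c hc h0' hn h6' hd
  have hs0 : ∑ j ∈ range 7, c (j + 1) ≤ 3 * c 0 + 1 := by rw [sum_slots_eq]; omega
  have hs1 : ∑ j ∈ range 7, c1 (j + 1) ≤ 3 * c1 0 + 1 := by rw [sum_slots_eq, hd1]; omega
  have hs2 : ∑ j ∈ range 7, c2 (j + 1) ≤ 3 * c2 0 + 1 := by rw [sum_slots_eq, hd2]; omega
  refine ⟨?_, ?_⟩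
  · have key := coeff_rel_of_summable c c1 c2 (c 0).toNat hN hc hB1 hB2 hs0 hs1 hs2
      rfl (by rw [e10]) (by rw [e20]) (faceG0 c) (faceG1 c) (faceG2 c) (faceTelescoper c) hg hpoly
    linear_combination key.2
  · have hpoly4 : C (faceG0 c) * numPoly c + C (faceG1 c) * numPoly c1 + C (faceG2 c) * numPoly c2 +
        C (0 : ℚ) * numPoly c =
        (faceTelescoper c).comp (X + C 1) * X ^ 6 - faceTelescoper c * (X + C (((c 0).toNat : ℕ) : ℚ)) ^ 6 := by
      rw [map_zero, zero_mul, add_zero]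
      exact hpoly
    have key := coeffV_rel_of_summable4 c c1 c2 c (c 0).toNat hN hc hB1 hB2 hc hs0 hs1 hs2 hs0
      rfl (by rw [e10]) (by rw [e20]) rfl (faceG0 c) (faceG1 c) (faceG2 c) 0 (faceTelescoper c) hg hpoly4
    rw [eval_faceTelescoper_one, zero_div] at key
    linear_combination key

/-! ### 9. Consequences: the ghost-face stratum of gen-1's bridge is a theorem -/

/-- **Both face recurrences of `V∧W` hold** (node `CasVWFace16` of `Elimination/DictBridgeFace`, PROVED). -/
theorem casVWFace16_holds : CasVWFace16 := by
  intro c hc h1 h6 hd h2 h3 h4 h5 h7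
  obtain ⟨hW, hV⟩ := face16_threeTerm c hc h1 h6 hd h7
  have hN : 0 ≤ c 0 := hc.1
  have h7' : c 7 + 1 ≤ c 0 := by omega
  have hf : ((c 0 : ℚ) - c 7 + 1) ≠ 0 := by
    have h : ((c 7 : ℚ)) + 1 ≤ (c 0 : ℚ) := by exact_mod_cast h7'
    intro h0
    linarith
  refine ⟨?_, ?_⟩
  · have h := casVW_bump6_of_threeTerm hf hW hV
    unfold facePi at h
    linear_combination h
  · have h := casVW_dsShift_of_threeTerm hc hd h7' hf hW hV
    unfold faceE at h
    linear_combination h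

/-- **gen-1's `DictBridge` on the ghost-face stratum** (node `DictBridgeFace16`, PROVED). -/
theorem dictBridgeFace16_holds : DictBridgeFace16 := dictBridgeFace16_of casVWFace16_holds

/-- The residual boundary node of `Elimination/DictBridge` from the level-`1` clusters alone. -/
theorem dictBridgeBoundary_of_levelOne (hL : DictBridgeLevelOne) : DictBridgeBoundary :=
  dictBridgeBoundary_of dictBridgeFace16_holds hL

/-- **gen-1's GLOBAL `DictBridge` from the three level-`1` clusters alone.** -/
theorem dictBridge_of_levelOne (hL : DictBridgeLevelOne) : DictBridge := dictBridge_of_strata casVWFace16_holds hL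

end Summit.KontsevichZagierPeriods.Zeta5Search.Elimination
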